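import Mathlib.LinearAlgebra.FreeModule.ModN
import Literature.NumberTheory.EllipticCurves.BSDWave0
import Literature.NumberTheory.EllipticCurves.BSDSelmer
import Literature.NumberTheory.EllipticCurves.MordellWeilTheoremProofs
import Literature.NumberTheory.EllipticCurves.SelmerProofs
import Literature.NumberTheory.EllipticCurves.SelmerFiniteProofs
import HarnessLib

/-!
# Bhargava–Shankar, Cor. 1.2: the average rank is at most `3/2`, from the `2`-Selmer average

Topic `Literature/NumberTheory/EllipticCurves`; proof material for the named fact
`Literature.NumberTheory.EllipticCurves.averageRankLE_three_halves` (`BSDWave0.lean`, inventory **bsd.S26**): when elliptic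
curves `E/ℚ` are ordered by naive height, `limsup` of the average Mordell–Weil rank is `≤ 3/2`.

## Source and triage

M. Bhargava, A. Shankar, *Binary quartic forms having bounded invariants, and the boundedness of
the average rank of elliptic curves*, Ann. of Math. (2) 181 (2015) 191–242 = arXiv:1006.1002,
§1.1 (p. 3 of the arXiv version):

* **Theorem 1.1.** When all elliptic curves `E/ℚ` are ordered by height, the average size of the
  `2`-Selmer group `S₂(E)` is `3`.
* **Corollary 1.2.** When all elliptic curves over `ℚ` are ordered by height, their average
  `2`-Selmer rank is at most `1.5`; thus their average rank is also at most `1.5`.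
  Printed proof: the exact sequence `0 → E(ℚ)/2E(ℚ) → S₂(E) → Ш_E[2] → 0` (displayed in
  §1.1) gives `r₂(S₂(E)) = r(E) + r₂(E[2]) + r₂(Ш_E[2])`, so `r(E) ≤ r₂(S₂(E)) = s` with
  `#S₂(E) = 2^s`; and since `2s ≤ 2^s`, Theorem 1.1 bounds the average of `s` by `1.5`.

(The vendored docstring of `averageRankLE_three_halves` says "Thm 1.2"; in the held arXiv text the
average-rank clause is **Corollary 1.2** of Theorem 1.1 — same content.)

Theorem 1.1 is the entire 35-page paper (counting `GL₂(ℤ)`-classes of integral binary quartic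
forms of bounded height by geometry of numbers, §2; parametrising `2`-Selmer elements by locally
soluble binary quartics and sieving to the height family, §3) and has no Mathlib support; it stays
the named fact `Literature.NumberTheory.EllipticCurves.average_card_selmerTwo` / `Literature.NumberTheory.EllipticCurves.heightAverageLE_card_selmerTwo`
(`BSDSelmer.lean`). This file proves, sorry-free, everything in Corollary 1.2 *downstream* of
Theorem 1.1:

* `WeierstrassCurve.pow_mordellWeilRank_le_card_selmerGroup`: for an elliptic curve `E` over a
  number field `K` and `n ≥ 1`, **`n ^ rank E(K) ≤ #Sel^(n)(E/K)`** — from the tree's *proved*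
  Mordell–Weil theorem (`module_finite_point_holds`, Silverman AEC VIII.6.7) and Kummer sequence
  (`exists_kummerMap_holds`: `E(K)/nE(K) ≅ im κ ⊆ Sel^(n)(E/K)`, AEC X.4.2(a)), via the surjection
  `E(K)/nE(K) ↠ (E(K)/E(K)_tors)/n ≅ (ℤ/n)^rank` (Mathlib `ModN.natCard_eq`). The finiteness of
  `Sel^(n)(E/K)` (AEC X.4.2(b), named fact `WeierstrassCurve.finite_selmerGroup`, not yet
  discharged in the tree) is a hypothesis: with Mathlib's junk value `Nat.card = 0` on infinite
  types the inequality is false without it.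
* `Literature.NumberTheory.EllipticCurves.heightAverage_mono`, `Literature.NumberTheory.EllipticCurves.heightAverage_const_mul`, `Literature.NumberTheory.EllipticCurves.HeightAverageLE.of_le_const_mul`,
  `Literature.NumberTheory.EllipticCurves.HeightAverageLE.of_tendsto`: elementary algebra of height averages (`limsup` form).
* the `Tendsto` form of Theorem 1.1 (`average_card_selmerTwo`) implies its `limsup` form
  (`heightAverageLE_card_selmerTwo`) by `Literature.NumberTheory.EllipticCurves.HeightAverageLE.of_tendsto`.
* `Literature.NumberTheory.EllipticCurves.heightAverageLE_selmerTwoRank_of_facts`: first clause of Cor. 1.2 — the average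
  `2`-Selmer rank `log₂ #S₂(E)` is `≤ 3/2`, from Theorem 1.1.
* `Literature.NumberTheory.EllipticCurves.averageRankLE_three_halves_of_facts`: **Cor. 1.2** — `averageRankLE_three_halves`
  from Theorem 1.1 (`heightAverageLE_card_selmerTwo`) and AEC X.4.2(b) for the curves `E_{A,B}`
  (`finite_selmerGroup`); `…_of_average_card_selmerTwo`: the same from the `Tendsto` form.

* `Literature.NumberTheory.EllipticCurves.averageRankLE_three_halves_of_heightAverageLE_card_selmerTwo` (§ "AEC X.4.2(b)
  discharged", appended): since `WeierstrassCurve.finite_selmerGroup` is now proved in the tree for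
  every elliptic curve over a number field (`WeierstrassCurve.finite_selmerGroup_holds`, file
  `SelmerFiniteProofs`), Cor. 1.2 holds granted Theorem 1.1 alone; likewise the descent inequality
  `n ^ rank E(K) ≤ #Sel^(n)(E/K)` becomes unconditional (`pow_rank_le_card_selmerGroup`).

What `averageRankLE_three_halves_holds` still needs: a discharge of `heightAverageLE_card_selmerTwo`
(Bhargava–Shankar Thm 1.1 itself; its decomposition into the paper's intermediate results is in
`BinaryQuarticForms.lean` and its companions).

## Design

* Theorems only (`--kind proof`); the statement files `BSDWave0.lean`, `BSDSelmer.lean` are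
  untouched. The descent inequality is placed in `namespace WeierstrassCurve` as a deliberate
  dot-notation extension (like the Selmer vocabulary of `Selmer.lean`); the height-average algebra
  in `namespace Literature` next to `Literature.NumberTheory.EllipticCurves.heightAverage`; the corollary in `namespace Literature.BSD` next to the
  fact it serves. `noncomputable section`, `open scoped Classical`, as in those files.

## References

* M. Bhargava, A. Shankar, Ann. of Math. (2) 181 (2015) 191–242, doi:10.4007/annals.2015.181.1.3,
  arXiv:1006.1002: Thm 1.1, Cor. 1.2 and its proof (§1.1, p. 3 of the arXiv text).
  [cite: BhargavaShankarAnnals2015, Cor. 1.2]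
* J. H. Silverman, *The Arithmetic of Elliptic Curves*, GTM 106, 2nd ed. (2009): Thm VIII.6.7,
  Thm X.4.2. [cite: SilvermanAEC2009, Thm X.4.2]
-/

noncomputable section

open scoped Classical
open Filter Topology

/-! ## The descent inequality `n ^ rank E(K) ≤ #Sel^(n)(E/K)` -/

namespace WeierstrassCurve

universe u

variable {K : Type u} [Field K] [NumberField K] (W : WeierstrassCurve K) [W.IsElliptic]

/-- **Descent inequality** (Silverman, *AEC*, Thm X.4.2(a) with Thm VIII.6.7; Bhargava–Shankar,
Ann. of Math. 181 (2015), §1.1, proof of Cor. 1.2: `r(E) ≤ r₂(S₂(E))`). For an elliptic curve `E` over a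
number field `K` and an integer `n ≥ 1`, if `Sel^(n)(E/K)` is finite (AEC X.4.2(b), the named fact
`finite_selmerGroup`, hypothesis `hfin`) then `n ^ rank E(K) ≤ #Sel^(n)(E/K)`.
Proof: by the Kummer sequence (`exists_kummerMap_holds`) `E(K)/nE(K) ≅ im κ ⊆ Sel^(n)(E/K)`; by
Mordell–Weil (`module_finite_point_holds`) `F = E(K)/E(K)_tors` is free of rank `r = rank E(K)`
(`module_free_mordellWeilModTorsion`, `finrank_mordellWeilModTorsion_eq_holds`), and
`E(K) ↠ F ↠ F/nF` kills `nE(K)`, so `#(E(K)/nE(K)) ≥ #(F/nF) = n^r` (Mathlib `ModN.natCard_eq`).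
[cite: SilvermanAEC2009, Thm X.4.2] -/
theorem pow_mordellWeilRank_le_card_selmerGroup (hfin : W.finite_selmerGroup) {n : ℕ}
    (hn : n ≠ 0) : n ^ W.mordellWeilRank ≤ Nat.card (W.selmerGroup n) := by
  haveI : NeZero n := ⟨hn⟩
  have hn' : (n : ℤ) ≠ 0 := Int.natCast_ne_zero.mpr hn
  haveI hSel : Finite (W.selmerGroup n) := hfin hn'
  obtain ⟨κ, hker, hrange⟩ := W.exists_kummerMap_holds hn'
  -- Mordell–Weil: `E(K)` is finitely generated, `F = E(K)/tors` is free of rank `rank E(K)`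
  haveI : Module.Finite ℤ W.toAffine.Point := W.module_finite_point_holds
  haveI : Module.Free ℤ (mordellWeilModTorsion W) :=
    module_free_mordellWeilModTorsion W W.module_finite_point_holds
  haveI : Module.Finite ℤ (mordellWeilModTorsion W) :=
    Module.Finite.of_surjective
      ((QuotientAddGroup.mk' (AddCommGroup.torsion W.toAffine.Point)).toIntLinearMap)
      (QuotientAddGroup.mk'_surjective (AddCommGroup.torsion W.toAffine.Point))
  have hrank : Module.finrank ℤ (mordellWeilModTorsion W) = W.mordellWeilRank :=
    finrank_mordellWeilModTorsion_eq_holds W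
  -- `φ : E(K) ↠ F ↠ F/nF` kills `nE(K) = ker κ`
  let φ : W.toAffine.Point →+ ModN (mordellWeilModTorsion W) n :=
    (ModN.mkQ (G := mordellWeilModTorsion W) n).comp
      (QuotientAddGroup.mk' (AddCommGroup.torsion W.toAffine.Point))
  have hφ : Function.Surjective φ :=
    (Submodule.mkQ_surjective _).comp (QuotientAddGroup.mk'_surjective _)
  have hkill : ∀ x : ModN (mordellWeilModTorsion W) n, (n : ℤ) • x = 0 := fun x ↦ by
    rw [natCast_zsmul, ← Nat.cast_smul_eq_nsmul (ZMod n), ZMod.natCast_self, zero_smul]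
  have hle : κ.ker ≤ φ.ker := by
    rw [hker]
    rintro _ ⟨m, rfl⟩
    rw [AddMonoidHom.mem_ker, zsmulAddGroupHom_apply, map_zsmul, hkill]
  -- counting: `#(F/nF) ≤ #(E(K)/ker κ) = #(im κ) ≤ #Sel^(n)`
  have hsub : κ.range ≤ W.selmerGroup n := hrange ▸ inf_le_left
  haveI : Finite κ.range :=
    Finite.of_injective _ (AddSubgroup.inclusion_injective hsub)
  haveI : Finite (W.toAffine.Point ⧸ κ.ker) :=
    Finite.of_equiv _ (QuotientAddGroup.quotientKerEquivRange κ).toEquiv.symm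
  have h1 : Nat.card (ModN (mordellWeilModTorsion W) n) ≤ Nat.card (W.toAffine.Point ⧸ κ.ker) := by
    refine Nat.card_le_card_of_surjective (QuotientAddGroup.lift κ.ker φ hle) fun y ↦ ?_
    obtain ⟨m, rfl⟩ := hφ y
    exact ⟨m, QuotientAddGroup.lift_mk κ.ker hle m⟩
  have h2 : Nat.card (W.toAffine.Point ⧸ κ.ker) = Nat.card κ.range :=
    Nat.card_congr (QuotientAddGroup.quotientKerEquivRange κ).toEquiv
  have h3 : Nat.card κ.range ≤ Nat.card (W.selmerGroup n) :=
    Nat.card_le_card_of_injective _ (AddSubgroup.inclusion_injective hsub)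
  rw [ModN.natCard_eq, hrank, h2] at h1
  exact h1.trans h3

end WeierstrassCurve

/-! ## Algebra of height averages -/

namespace Literature.NumberTheory.EllipticCurves

/-- Monotonicity of the height average: if `f ≤ g` on the height family then
`Avg_{H < X} f ≤ Avg_{H < X} g` (elementary). [folklore] -/
theorem heightAverage_mono {f g : ℤ × ℤ → ℝ} (h : ∀ AB, IsInHeightFamily AB → f AB ≤ g AB)
    (X : ℕ) : heightAverage f X ≤ heightAverage g X := by
  unfold heightAverage
  exact div_le_div_of_nonneg_right
    (Finset.sum_le_sum fun AB hAB ↦ h AB ((mem_heightFamilyBelow_iff AB X).1 hAB).1)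
    (Nat.cast_nonneg _)

/-- Linearity of the height average in a constant factor: `Avg (c • f) = c • Avg f`
(elementary). [folklore] -/
theorem heightAverage_const_mul (c : ℝ) (f : ℤ × ℤ → ℝ) (X : ℕ) :
    heightAverage (fun AB ↦ c * f AB) X = c * heightAverage f X := by
  unfold heightAverage
  rw [← Finset.mul_sum, mul_div_assoc]

/-- Comparison of `limsup` averages: if `limsup Avg g ≤ c`, `0 < a` and `f ≤ a • g` on the height
family, then `limsup Avg f ≤ a c` (elementary; the averaging step of Bhargava–Shankar, Ann. of
Math. 181 (2015), proof of Cor. 1.2). [folklore] -/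
theorem HeightAverageLE.of_le_const_mul {f g : ℤ × ℤ → ℝ} {c a : ℝ} (hg : HeightAverageLE g c)
    (ha : 0 < a) (hfg : ∀ AB, IsInHeightFamily AB → f AB ≤ a * g AB) :
    HeightAverageLE f (a * c) := by
  intro ε hε
  filter_upwards [hg (ε / a) (div_pos hε ha)] with X hX
  have ha' : a ≠ 0 := ha.ne'
  calc heightAverage f X ≤ heightAverage (fun AB ↦ a * g AB) X := heightAverage_mono hfg X
    _ = a * heightAverage g X := heightAverage_const_mul a g X
    _ ≤ a * (c + ε / a) := mul_le_mul_of_nonneg_left hX ha.le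
    _ = a * c + ε := by field_simp

/-- A convergent average is in particular `limsup`-bounded by its limit:
`Avg_{H < X} f → c` implies `HeightAverageLE f c` (elementary). [folklore] -/
theorem HeightAverageLE.of_tendsto {f : ℤ × ℤ → ℝ} {c : ℝ}
    (h : Tendsto (fun X ↦ heightAverage f X) atTop (𝓝 c)) : HeightAverageLE f c :=
  fun _ε hε ↦ (h.eventually (Iio_mem_nhds (lt_add_of_pos_right c hε))).mono fun _ hX ↦ le_of_lt hX

/-- `2 r ≤ 2 ^ r` for every natural number `r` (the inequality `2s ≤ 2^s` used by
Bhargava–Shankar, Ann. of Math. 181 (2015), proof of Cor. 1.2; elementary). [folklore] -/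
theorem two_mul_le_two_pow (r : ℕ) : 2 * r ≤ 2 ^ r := by
  induction r with
  | zero => simp
  | succ k ih =>
    rcases Nat.eq_zero_or_pos k with rfl | hk
    · simp
    · calc 2 * (k + 1) ≤ 2 * k + 2 * k := by omega
        _ ≤ 2 ^ k + 2 ^ k := Nat.add_le_add ih ih
        _ = 2 ^ (k + 1) := by rw [Nat.pow_succ]; ring

end Literature.NumberTheory.EllipticCurves

/-! ## Corollary 1.2 from Theorem 1.1 -/

namespace Literature.NumberTheory.EllipticCurves

open WeierstrassCurve

/-- Pointwise input of Cor. 1.2 for the curves of the height family: for `(A, B)` in the family,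
`rank E_{A,B}(ℚ) ≤ ½ · #Sel^(2)(E_{A,B}/ℚ)`, from `2^r ≤ #Sel^(2)`
(`pow_mordellWeilRank_le_card_selmerGroup`, granted AEC X.4.2(b) `finite_selmerGroup` for the
curves over `ℚ`, hypothesis `hB`) and `2r ≤ 2^r` (Bhargava–Shankar, Ann. of Math. 181 (2015),
§1.1, proof of Cor. 1.2). [cite: BhargavaShankarAnnals2015, Cor. 1.2 (proof)] -/
theorem mordellWeilRank_le_half_mul_card_selmerGroup_two
    (hB : ∀ W : WeierstrassCurve ℚ, W.finite_selmerGroup) {AB : ℤ × ℤ}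
    (hAB : IsInHeightFamily AB) :
    ((shortWeierstrass AB).mordellWeilRank : ℝ) ≤
      (1 / 2) * (Nat.card ((shortWeierstrass AB).selmerGroup 2) : ℝ) := by
  haveI := isElliptic_shortWeierstrass hAB
  have h := (shortWeierstrass AB).pow_mordellWeilRank_le_card_selmerGroup (hB _) two_ne_zero
  rw [Nat.cast_ofNat] at h
  have h2 := (two_mul_le_two_pow (shortWeierstrass AB).mordellWeilRank).trans h
  have h3 : (2 * (shortWeierstrass AB).mordellWeilRank : ℝ) ≤
      (Nat.card ((shortWeierstrass AB).selmerGroup 2) : ℝ) := by exact_mod_cast h2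
  linarith

/-- Same pointwise bound for the `2`-Selmer rank `s = log₂ #Sel^(2)(E/ℚ)`: `s ≤ ½ · #Sel^(2)`,
i.e. `2s ≤ 2^s ≤ #Sel^(2)` (Bhargava–Shankar, §1.1, proof of Cor. 1.2; elementary, no finiteness
needed since `log₂ 0 = 0`). [cite: BhargavaShankarAnnals2015, Cor. 1.2 (proof)] -/
theorem log_card_selmerGroup_two_le_half_mul_card (W : WeierstrassCurve ℚ) :
    (Nat.log 2 (Nat.card (W.selmerGroup 2)) : ℝ) ≤ (1 / 2) * (Nat.card (W.selmerGroup 2) : ℝ) := by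
  set c := Nat.card (W.selmerGroup 2)
  rcases Nat.eq_zero_or_pos c with hc | hc
  · simp [hc]
  · have h2 := (two_mul_le_two_pow (Nat.log 2 c)).trans (Nat.pow_log_le_self 2 hc.ne')
    have h3 : (2 * Nat.log 2 c : ℝ) ≤ (c : ℝ) := by exact_mod_cast h2
    linarith

/-- **Bhargava–Shankar, Cor. 1.2, first clause** (Ann. of Math. 181 (2015), §1.1): granted
Theorem 1.1 in `limsup` form (`heightAverageLE_card_selmerTwo`, hypothesis `hA`), when elliptic
curves over `ℚ` are ordered by height their average `2`-Selmer rank `s(E) = log₂ #Sel^(2)(E/ℚ)` is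
at most `3/2` (`limsup` form). Proof as printed: `2s ≤ 2^s = #Sel^(2)`, then average.
[cite: BhargavaShankarAnnals2015, Cor. 1.2] -/
theorem heightAverageLE_selmerTwoRank_of_facts (hA : heightAverageLE_card_selmerTwo) :
    HeightAverageLE
      (fun AB ↦ (Nat.log 2 (Nat.card ((shortWeierstrass AB).selmerGroup 2)) : ℝ)) (3 / 2) := by
  have h := HeightAverageLE.of_le_const_mul hA one_half_pos
    fun AB _ ↦ log_card_selmerGroup_two_le_half_mul_card (shortWeierstrass AB)
  norm_num at h
  exact h

/-- **Bhargava–Shankar, Cor. 1.2** (Ann. of Math. 181 (2015) 191–242, §1.1; arXiv:1006.1002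
p. 3): granted Theorem 1.1 in `limsup` form (`heightAverageLE_card_selmerTwo`: the average of
`#Sel^(2)(E/ℚ)` over curves of height `< X` is eventually `≤ 3 + ε`; hypothesis `hA`) and the
finiteness of `Sel^(2)(E/ℚ)` (Silverman AEC X.4.2(b), named fact `finite_selmerGroup`;
hypothesis `hB`), the average Mordell–Weil rank of elliptic curves over `ℚ` ordered by naive
height is at most `3/2`: the named fact `averageRankLE_three_halves`. Proof as printed:
`r(E) ≤ s(E)` by `0 → E(ℚ)/2E(ℚ) → S₂(E) → Ш_E[2] → 0` and Mordell–Weil (here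
`pow_mordellWeilRank_le_card_selmerGroup`: `2^r ≤ #S₂(E)`), `2s ≤ 2^s`, and averaging
(`HeightAverageLE.of_le_const_mul`). [cite: BhargavaShankarAnnals2015, Cor. 1.2] -/
theorem averageRankLE_three_halves_of_facts (hA : heightAverageLE_card_selmerTwo)
    (hB : ∀ W : WeierstrassCurve ℚ, W.finite_selmerGroup) : averageRankLE_three_halves := by
  have h := HeightAverageLE.of_le_const_mul hA one_half_pos
    fun AB hAB ↦ mordellWeilRank_le_half_mul_card_selmerGroup_two hB hAB
  norm_num at h
  exact h

/-- **Bhargava–Shankar, Cor. 1.2**, from Theorem 1.1 in its `Tendsto` form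
(`average_card_selmerTwo`: the average of `#Sel^(2)(E/ℚ)` tends to `3`) and AEC X.4.2(b)
(`finite_selmerGroup` over `ℚ`): the average rank is at most `3/2`
(`averageRankLE_three_halves`). [cite: BhargavaShankarAnnals2015, Cor. 1.2] -/
theorem averageRankLE_three_halves_of_average_card_selmerTwo (hA : average_card_selmerTwo)
    (hB : ∀ W : WeierstrassCurve ℚ, W.finite_selmerGroup) : averageRankLE_three_halves :=
  averageRankLE_three_halves_of_facts (HeightAverageLE.of_tendsto hA) hB

end Literature.NumberTheory.EllipticCurves

/-! ## AEC X.4.2(b) discharged: Corollary 1.2 granted Theorem 1.1 alone -/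

namespace WeierstrassCurve

variable {K : Type*} [Field K] [NumberField K] (W : WeierstrassCurve K) [W.IsElliptic]

/-- **Descent inequality, unconditional form** (Silverman, *AEC*, Thm X.4.2 with Thm VIII.6.7):
for an elliptic curve `E` over a number field `K` and `n ≥ 1`, `n ^ rank E(K) ≤ #Sel^(n)(E/K)`.
This is `pow_mordellWeilRank_le_card_selmerGroup` with its finiteness hypothesis (AEC X.4.2(b))
fed by the tree's discharge `finite_selmerGroup_holds` (`SelmerFiniteProofs`).
[cite: SilvermanAEC2009, Thm X.4.2] -/
theorem pow_rank_le_card_selmerGroup {n : ℕ} (hn : n ≠ 0) :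
    n ^ W.mordellWeilRank ≤ Nat.card (W.selmerGroup n) :=
  W.pow_mordellWeilRank_le_card_selmerGroup W.finite_selmerGroup_holds hn

end WeierstrassCurve

namespace Literature.NumberTheory.EllipticCurves

open WeierstrassCurve

/-- Pointwise input of Cor. 1.2, unconditional: for `(A, B)` in the height family,
`rank E_{A,B}(ℚ) ≤ ½ · #Sel^(2)(E_{A,B}/ℚ)` (`2r ≤ 2^r ≤ #Sel^(2)`; Bhargava–Shankar, Ann. of
Math. 181 (2015), §1.1, proof of Cor. 1.2; AEC X.4.2(b) supplied by `finite_selmerGroup_holds`).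
[cite: BhargavaShankarAnnals2015, Cor. 1.2 (proof)] -/
theorem mordellWeilRank_le_half_card_selmerTwo {AB : ℤ × ℤ} (hAB : IsInHeightFamily AB) :
    ((shortWeierstrass AB).mordellWeilRank : ℝ) ≤
      (1 / 2) * (Nat.card ((shortWeierstrass AB).selmerGroup 2) : ℝ) :=
  mordellWeilRank_le_half_mul_card_selmerGroup_two (fun W ↦ W.finite_selmerGroup_holds) hAB

/-- **Bhargava–Shankar, Cor. 1.2, granted Theorem 1.1 alone** (Ann. of Math. 181 (2015)
191–242, §1.1): if the average of `#Sel^(2)(E/ℚ)` over the curves of naive height `< X` is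
eventually `≤ 3 + ε` (`heightAverageLE_card_selmerTwo`, Theorem 1.1 in `limsup` form; hypothesis
`hA`), then the average Mordell–Weil rank is at most `3/2` (`averageRankLE_three_halves`). The
second input of `averageRankLE_three_halves_of_facts`, the finiteness of `Sel^(2)(E/ℚ)`
(AEC X.4.2(b)), is now a theorem of the tree (`WeierstrassCurve.finite_selmerGroup_holds`).
[cite: BhargavaShankarAnnals2015, Cor. 1.2] -/
theorem averageRankLE_three_halves_of_heightAverageLE_card_selmerTwo
    (hA : heightAverageLE_card_selmerTwo) : averageRankLE_three_halves :=
  averageRankLE_three_halves_of_facts hA fun W ↦ W.finite_selmerGroup_holds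

/-- **Bhargava–Shankar, Cor. 1.2, granted Theorem 1.1 alone**, `Tendsto` form: if the average of
`#Sel^(2)(E/ℚ)` tends to `3` (`average_card_selmerTwo`), the average rank is at most `3/2`
(`averageRankLE_three_halves`). [cite: BhargavaShankarAnnals2015, Cor. 1.2] -/
theorem averageRankLE_three_halves_of_tendsto (hA : average_card_selmerTwo) :
    averageRankLE_three_halves :=
  averageRankLE_three_halves_of_heightAverageLE_card_selmerTwo (HeightAverageLE.of_tendsto hA)

end Literature.NumberTheory.EllipticCurves

end
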